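import Mathlib
import Summits.MatrixMultiplication.MatrixMultiplication.Theorems.SnSubsetDichotomyHyperoctahedralThresholdRotationIdentity

/-!
# Involution words that act alike are a relator
(crux `SnSubsetDichotomy.HyperoctahedralThreshold`, stmt-MatrixMultiplication-10883, refutation line
`refutation-local-symmetry`; `--supports` helper for the open core `stub_poorRigidCore`; siege seat k11,
variation "direct pigeonhole on involution words")

Vocabulary of the line: `μ 0, μ 1, μ 2` are involutions of `Fin n` (the three perfect matchings of a host);
a colour word `w : List (Fin 3)` acts on the right, `x · w := w.foldl (fun v c => μ c v) x`.  An
**involution word** is `w ++ c :: w.reverse` with `w ++ [c]` reduced (`List.IsChain (· ≠ ·)`): it acts as the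
conjugate `w c w⁻¹` of the letter `c`, a fixed-point-free involution when the `μ c` are.  The pigeonhole of the
variation (crux NOTES §2 (S-refl); landed as `…ReflectionSupply`, p-tree) lets the `≈ 6·2^L` involution words
of radius `≤ L` collide AT A VERTEX.  This file settles the complementary, GLOBAL degeneracy: two distinct
involution words that agree at EVERY vertex.

* `relator_of_invWord_eq` (registered as `stub_involutionWordRelator`): if `(w, c) ≠ (w', c')` and the two
  involution words act identically, then some nonempty cyclically reduced word `z` with
  `|z| ≤ 2(|w| + |w'|) + 2` fixes every vertex (a relator of the colour group).  Proof: strip a common first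
  letter (conjugation) and recurse; when the first letters differ (or one word is empty and the other does
  not start with the lone letter) the product `c · w⁻¹ · w' c' w'⁻¹ · w` is already cyclically reduced.
* `invWord_injective_of_noRelator`: contrapositive — if no nonempty cyclically reduced word of length
  `≤ 4L + 2` fixes every vertex, involution words of radius `≤ L` are pairwise distinct AS PERMUTATIONS.
* `invWord_injective_of_poor`: the same under the POORNESS hypothesis of `stub_poorRigidCore` verbatim
  (a relator has the `n` distinct fixed points `id : Fin n → Fin n`, more than the poorness threshold
  `(4|z|²)^(⌊log₂|z|⌋+1)·(|R|+1)` once that threshold at length `4L+2` is `< n` and `4L + 2 ≤ n^{1/4}`).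

So under the hypotheses of the open core the involution words of radius `≤ L` form `3·2^(L+1) − 3` DISTINCT
fixed-point-free involutions of `Fin n` (perfect matchings), the normalisation "Case 1 (relator) is vacuous"
of the variation; the rich/relator case itself is discharged by the line's landed `stub_richDescent`.
Pure finite combinatorics; hypothesis only `μ c * μ c = 1` (no fixed-point-freeness, any `n`).  Reuses
`Rotation.foldl_act_reverse` / `Rotation.foldl_reverse_act` (sibling file `…RotationIdentity`, p111510).
-/

-- the project's summit namespace `Summit.MatrixMultiplication.MatrixMultiplication` repeats a component by design (D-0022)
set_option linter.dupNamespace false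

namespace Summit.MatrixMultiplication.MatrixMultiplication.Theorems.HyperoctahedralThreshold.InvolutionWordRelator

variable {n : ℕ}

/-! ### The right action of colour words
(`foldl_act_reverse` / `foldl_reverse_act` — walking back along the reversed word undoes the walk — are the
sibling file's `…RotationIdentity`, namespace `…HyperoctahedralThreshold.Rotation`, p111510.) -/

open Rotation (foldl_act_reverse foldl_reverse_act)

/-- The involution word of `a :: w` acts as the conjugate by `μ a` of the involution word of `w`. -/
theorem invWord_cons_act (μ : Fin 3 → Equiv.Perm (Fin n)) (a c : Fin 3) (w : List (Fin 3)) (v : Fin n) :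
    ((a :: w) ++ c :: (a :: w).reverse).foldl (fun v d => μ d v) v =
      μ a ((w ++ c :: w.reverse).foldl (fun v d => μ d v) (μ a v)) := by
  simp [List.foldl_append]

/-! ### Reducedness bookkeeping -/

/-- A reduced word stays reduced when reversed (the relation `≠` is symmetric). -/
theorem isChain_ne_reverse {w : List (Fin 3)} (h : List.IsChain (· ≠ ·) w) :
    List.IsChain (· ≠ ·) w.reverse :=
  List.isChain_reverse.2 (h.imp fun _ _ hab => Ne.symm hab)

/-- The involution word `w ++ c' :: w.reverse` of a reduced `w ++ [c']` is reduced. -/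
theorem isChain_invWord {w : List (Fin 3)} {c' : Fin 3} (h : List.IsChain (· ≠ ·) (w ++ [c'])) :
    List.IsChain (· ≠ ·) (w ++ c' :: w.reverse) := by
  have h2 : List.IsChain (· ≠ ·) ([c'] ++ w.reverse) := by
    have := isChain_ne_reverse h
    simpa using this
  have := List.IsChain.append_overlap h h2 (by simp)
  simpa using this

/-- The last letter of `w` differs from `c` when `w ++ [c]` is reduced. -/
theorem getLast?_ne_of_isChain {w : List (Fin 3)} {c : Fin 3} (h : List.IsChain (· ≠ ·) (w ++ [c])) :
    ∀ x ∈ w.getLast?, x ≠ c := by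
  intro x hx
  exact (List.isChain_append.1 h).2.2 x hx c (by simp)

/-! ### One-sided case: a letter against an involution word -/

/-- **One-sided relator.**  If the letter `c` acts like the involution word `w' c' w'⁻¹` with
`(w', c') ≠ ([], c)`, then a nonempty cyclically reduced word of length `≤ 2|w'| + 2` fixes every vertex.
[this line; folklore] -/
theorem relator_of_letter_eq_invWord (μ : Fin 3 → Equiv.Perm (Fin n)) (hμ : ∀ c, μ c * μ c = 1) :
    ∀ (w' : List (Fin 3)) (c c' : Fin 3), List.IsChain (· ≠ ·) (w' ++ [c']) → (w' ≠ [] ∨ c ≠ c') →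
      (∀ v : Fin n, μ c v = (w' ++ c' :: w'.reverse).foldl (fun v d => μ d v) v) →
      ∃ z : List (Fin 3), z ≠ [] ∧ List.IsChain (· ≠ ·) (z ++ z) ∧ z.length ≤ 2 * w'.length + 2 ∧
        ∀ v : Fin n, z.foldl (fun v d => μ d v) v = v := by
  intro w'
  have hinv : ∀ (d : Fin 3) (x : Fin n), μ d (μ d x) = x := fun d x => by
    have h := congrArg (fun f : Equiv.Perm (Fin n) => f x) (hμ d)
    simpa using h
  induction w' with
  | nil =>
    intro c c' _ hne h
    have hcc' : c ≠ c' := by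
      rcases hne with h0 | h0
      · exact absurd rfl h0
      · exact h0
    refine ⟨[c, c'], by simp, ?_, by simp, ?_⟩
    · simp [hcc', hcc'.symm]
    · intro v
      have hv : μ c v = μ c' v := by simpa using h v
      simp only [List.foldl_cons, List.foldl_nil]
      rw [hv]
      exact hinv c' v
  | cons a w₁ ih =>
    intro c c' hch _ h
    by_cases hac : a = c
    · subst hac
      -- strip the common letter `a = c`: `μ c` agrees with the involution word of `w₁` too
      have h' : ∀ v : Fin n, μ a v = (w₁ ++ c' :: w₁.reverse).foldl (fun v d => μ d v) v := by
        intro u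
        have hu := h (μ a u)
        rw [invWord_cons_act, hinv] at hu
        -- hu : u = μ a (… u); apply `μ a` once more
        have h2 := congrArg (μ a) hu
        rw [hinv] at h2
        exact h2
      have hch' : List.IsChain (· ≠ ·) (w₁ ++ [c']) := by
        have : List.IsChain (· ≠ ·) (a :: (w₁ ++ [c'])) := by simpa using hch
        exact this.tail
      have hne' : w₁ ≠ [] ∨ a ≠ c' := by
        by_cases hw : w₁ = []
        · subst hw
          right
          have : List.IsChain (· ≠ ·) [a, c'] := by simpa using hch
          exact List.isChain_pair.1 this
        · exact Or.inl hw
      obtain ⟨z, hz0, hzc, hzl, hzf⟩ := ih a c' hch' hne' h'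
      exact ⟨z, hz0, hzc, by simp only [List.length_cons]; omega, hzf⟩
    · -- first letter `a ≠ c`: the product `c · (a w₁) c' (a w₁)⁻¹` is cyclically reduced
      set P : List (Fin 3) := (a :: w₁) ++ c' :: (a :: w₁).reverse with hP
      have hPc : List.IsChain (· ≠ ·) P := isChain_invWord hch
      have hPh : P.head? = some a := by simp [hP]
      have hPl : P.getLast? = some a :=
        List.getLast?_eq_some_iff.2 ⟨(a :: w₁) ++ c' :: w₁.reverse, by simp [hP]⟩
      have hcP : List.IsChain (· ≠ ·) (c :: P) :=
        List.isChain_cons.2 ⟨fun y hy => by rw [hPh] at hy; cases hy; exact fun h0 => hac h0.symm, hPc⟩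
      refine ⟨c :: P, by simp, ?_, ?_, ?_⟩
      · refine List.isChain_append.2 ⟨hcP, hcP, ?_⟩
        intro x hx y hy
        have hx' : x = a := by
          have : (c :: P).getLast? = some a := by
            rw [List.getLast?_cons, hPl]; rfl
          rw [this] at hx
          cases hx; rfl
        have hy' : y = c := by simpa using hy.symm
        rw [hx', hy']
        exact hac
      · simp only [hP, List.length_cons, List.length_append, List.length_reverse]
        omega
      · intro v
        rw [List.foldl_cons, ← h (μ c v)]
        exact hinv c v

/-! ### The relator lemma -/

/-- **Involution words that act alike are a relator** (registered helper `stub_involutionWordRelator`).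
If two involution words `w c w⁻¹ ≠ w' c' w'⁻¹` (as words: `w ≠ w'` or `c ≠ c'`; both `w ++ [c]`,
`w' ++ [c']` reduced) act identically on `Fin n`, then some nonempty cyclically reduced colour word of length
`≤ 2(|w| + |w'|) + 2` fixes every vertex. [this line; folklore] -/
theorem relator_of_invWord_eq (μ : Fin 3 → Equiv.Perm (Fin n)) (hμ : ∀ c, μ c * μ c = 1) :
    ∀ (w w' : List (Fin 3)) (c c' : Fin 3), List.IsChain (· ≠ ·) (w ++ [c]) →
      List.IsChain (· ≠ ·) (w' ++ [c']) → (w ≠ w' ∨ c ≠ c') →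
      (∀ v : Fin n, (w ++ c :: w.reverse).foldl (fun v d => μ d v) v =
        (w' ++ c' :: w'.reverse).foldl (fun v d => μ d v) v) →
      ∃ z : List (Fin 3), z ≠ [] ∧ List.IsChain (· ≠ ·) (z ++ z) ∧
        z.length ≤ 2 * (w.length + w'.length) + 2 ∧ ∀ v : Fin n, z.foldl (fun v d => μ d v) v = v := by
  intro w
  have hinv : ∀ (d : Fin 3) (x : Fin n), μ d (μ d x) = x := fun d x => by
    have h := congrArg (fun f : Equiv.Perm (Fin n) => f x) (hμ d)
    simpa using h
  induction w with
  | nil =>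
    intro w' c c' _ hch' hne h
    have hne' : w' ≠ [] ∨ c ≠ c' := hne.imp (fun h0 => fun h1 => h0 h1.symm) id
    have h1 : ∀ v : Fin n, μ c v = (w' ++ c' :: w'.reverse).foldl (fun v d => μ d v) v := by
      intro v; simpa using h v
    obtain ⟨z, hz0, hzc, hzl, hzf⟩ := relator_of_letter_eq_invWord μ hμ w' c c' hch' hne' h1
    exact ⟨z, hz0, hzc, by simp only [List.length_nil]; omega, hzf⟩
  | cons a w₁ ih =>
    intro w' c c' hch hch' hne h
    cases w' with
    | nil =>
      -- symmetric one-sided case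
      have hne' : (a :: w₁) ≠ [] ∨ c' ≠ c := Or.inl (by simp)
      have h1 : ∀ v : Fin n, μ c' v = ((a :: w₁) ++ c :: (a :: w₁).reverse).foldl (fun v d => μ d v) v := by
        intro v; simpa using (h v).symm
      obtain ⟨z, hz0, hzc, hzl, hzf⟩ := relator_of_letter_eq_invWord μ hμ (a :: w₁) c' c hch hne' h1
      exact ⟨z, hz0, hzc, by simp only [List.length_cons, List.length_nil] at hzl ⊢; omega, hzf⟩
    | cons b w₁' =>
      by_cases hab : a = b
      · subst hab
        -- strip the common first letter (conjugation by `μ a`) and recurse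
        have h' : ∀ v : Fin n, (w₁ ++ c :: w₁.reverse).foldl (fun v d => μ d v) v =
            (w₁' ++ c' :: w₁'.reverse).foldl (fun v d => μ d v) v := by
          intro u
          have hu := h (μ a u)
          rw [invWord_cons_act, invWord_cons_act, hinv] at hu
          exact (μ a).injective hu
        have hch₁ : List.IsChain (· ≠ ·) (w₁ ++ [c]) := by
          have : List.IsChain (· ≠ ·) (a :: (w₁ ++ [c])) := by simpa using hch
          exact this.tail
        have hch₁' : List.IsChain (· ≠ ·) (w₁' ++ [c']) := by
          have : List.IsChain (· ≠ ·) (a :: (w₁' ++ [c'])) := by simpa using hch'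
          exact this.tail
        have hne' : w₁ ≠ w₁' ∨ c ≠ c' := hne.imp (fun h0 h1 => h0 (by rw [h1])) id
        obtain ⟨z, hz0, hzc, hzl, hzf⟩ := ih w₁' c c' hch₁ hch₁' hne' h'
        exact ⟨z, hz0, hzc, by simp only [List.length_cons]; omega, hzf⟩
      · -- distinct first letters: `c · w⁻¹ · (w' c' w'⁻¹) · w` is cyclically reduced
        set w : List (Fin 3) := a :: w₁ with hw
        set w' : List (Fin 3) := b :: w₁' with hw'
        set P' : List (Fin 3) := w' ++ c' :: w'.reverse with hP'
        set Q : List (Fin 3) := w.reverse ++ P' ++ w with hQ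
        have hwc : List.IsChain (· ≠ ·) w := (List.isChain_append.1 hch).1
        have hwl : ∀ x ∈ w.getLast?, x ≠ c := getLast?_ne_of_isChain hch
        have hP'c : List.IsChain (· ≠ ·) P' := isChain_invWord hch'
        have hP'h : P'.head? = some b := by simp [hP', hw']
        have hP'l : P'.getLast? = some b :=
          List.getLast?_eq_some_iff.2 ⟨w' ++ c' :: w₁'.reverse, by simp [hP', hw']⟩
        have hwh : w.head? = some a := by simp [hw]
        have hwne : w ≠ [] := by simp [hw]
        -- the middle block `w⁻¹ P' w`
        have hQc : List.IsChain (· ≠ ·) Q := by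
          refine List.isChain_append.2 ⟨List.isChain_append.2 ⟨isChain_ne_reverse hwc, hP'c, ?_⟩, hwc, ?_⟩
          · intro x hx y hy
            rw [List.getLast?_reverse, hwh] at hx
            rw [hP'h] at hy
            cases hx; cases hy
            exact hab
          · intro x hx y hy
            have hx' : x = b := by
              rw [List.getLast?_append, hP'l] at hx
              simpa using hx.symm
            rw [hwh] at hy
            cases hy
            rw [hx']
            exact fun h0 => hab h0.symm
        have hQh : ∀ y ∈ Q.head?, y ≠ c := by
          intro y hy
          have : Q.head? = w.getLast? := by
            rw [hQ, List.append_assoc, List.head?_append, List.head?_reverse]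
            obtain ⟨x, hx⟩ := List.getLast?_isSome.2 hwne |> Option.isSome_iff_exists.1
            simp [hx]
          rw [this] at hy
          exact hwl y hy
        have hQl : Q.getLast? = w.getLast? := by
          rw [hQ, List.getLast?_append]
          obtain ⟨x, hx⟩ := List.getLast?_isSome.2 hwne |> Option.isSome_iff_exists.1
          simp [hx]
        have hcQ : List.IsChain (· ≠ ·) (c :: Q) :=
          List.isChain_cons.2 ⟨fun y hy => fun h0 => hQh y hy h0.symm, hQc⟩
        refine ⟨c :: Q, by simp, ?_, ?_, ?_⟩
        · refine List.isChain_append.2 ⟨hcQ, hcQ, ?_⟩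
          intro x hx y hy
          have hy' : y = c := by simpa using hy.symm
          have hx' : x ∈ w.getLast? := by
            rw [List.getLast?_cons, hQl] at hx
            obtain ⟨x0, hx0⟩ := List.getLast?_isSome.2 hwne |> Option.isSome_iff_exists.1
            rw [hx0] at hx ⊢
            simpa using hx
          rw [hy']
          exact hwl x hx'
        · simp [hQ, hP', hw, hw']
          omega
        · intro v
          -- `v · c w⁻¹ (w' c' w'⁻¹) w = v`, using that the two involution words agree at `v · c w⁻¹`
          have key : P'.foldl (fun v d => μ d v) (w.reverse.foldl (fun v d => μ d v) (μ c v)) =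
              w.reverse.foldl (fun v d => μ d v) v := by
            rw [hP', ← h]
            rw [List.foldl_append, foldl_reverse_act μ hμ, List.foldl_cons, hinv]
          rw [List.foldl_cons, hQ, List.foldl_append, List.foldl_append, key]
          exact foldl_reverse_act μ hμ w v

/-- **Registered form** (`ledger workitem stub-add stmt-MatrixMultiplication-10883 --name stub_involutionWordRelator`).
Two distinct involution words that act identically on `Fin n` yield a nonempty cyclically reduced relator of
length `≤ 2(|w| + |w'|) + 2` (a colour word fixing every vertex). [this line] -/
theorem stub_involutionWordRelator : ∀ (n : ℕ) (μ : Fin 3 → Equiv.Perm (Fin n)), (∀ c, μ c * μ c = 1) →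
    ∀ (w w' : List (Fin 3)) (c c' : Fin 3), List.IsChain (· ≠ ·) (w ++ [c]) →
    List.IsChain (· ≠ ·) (w' ++ [c']) → (w ≠ w' ∨ c ≠ c') →
    (∀ v : Fin n, (w ++ c :: w.reverse).foldl (fun v c => μ c v) v =
      (w' ++ c' :: w'.reverse).foldl (fun v c => μ c v) v) →
    ∃ z : List (Fin 3), z ≠ [] ∧ List.IsChain (· ≠ ·) (z ++ z) ∧
      z.length ≤ 2 * (w.length + w'.length) + 2 ∧ ∀ v : Fin n, z.foldl (fun v c => μ c v) v = v :=
  fun _ μ hμ w w' c c' hch hch' hne h => relator_of_invWord_eq μ hμ w w' c c' hch hch' hne h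

/-! ### Contrapositives: involution words are distinct permutations -/

/-- **No short relator ⇒ involution words of radius `≤ L` are pairwise distinct permutations.**
[this line] -/
theorem invWord_injective_of_noRelator (μ : Fin 3 → Equiv.Perm (Fin n)) (hμ : ∀ c, μ c * μ c = 1)
    (L : ℕ)
    (hno : ∀ z : List (Fin 3), z ≠ [] → List.IsChain (· ≠ ·) (z ++ z) → z.length ≤ 4 * L + 2 →
      ∃ v : Fin n, z.foldl (fun v c => μ c v) v ≠ v)
    (w w' : List (Fin 3)) (c c' : Fin 3) (hwL : w.length ≤ L) (hw'L : w'.length ≤ L)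
    (hch : List.IsChain (· ≠ ·) (w ++ [c])) (hch' : List.IsChain (· ≠ ·) (w' ++ [c']))
    (h : ∀ v : Fin n, (w ++ c :: w.reverse).foldl (fun v c => μ c v) v =
      (w' ++ c' :: w'.reverse).foldl (fun v c => μ c v) v) :
    w = w' ∧ c = c' := by
  by_contra hcon
  have hne : w ≠ w' ∨ c ≠ c' := by
    by_cases hw : w = w'
    · exact Or.inr fun hc => hcon ⟨hw, hc⟩
    · exact Or.inl hw
  obtain ⟨z, hz0, hzc, hzl, hzf⟩ := relator_of_invWord_eq μ hμ w w' c c' hch hch' hne h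
  obtain ⟨v, hv⟩ := hno z hz0 hzc (by omega)
  exact hv (hzf v)

/-- Monotonicity of the poorness threshold `(4ℓ²)^(⌊log₂ ℓ⌋+1)` in the length `ℓ`. [this line] -/
theorem threshold_mono {j ℓ : ℕ} (h : j ≤ ℓ) :
    (4 * j ^ 2) ^ (Nat.log 2 j + 1) ≤ (4 * ℓ ^ 2) ^ (Nat.log 2 ℓ + 1) := by
  rcases Nat.eq_zero_or_pos ℓ with rfl | hℓ
  · obtain rfl : j = 0 := Nat.le_zero.1 h
    exact le_rfl
  calc (4 * j ^ 2) ^ (Nat.log 2 j + 1) ≤ (4 * ℓ ^ 2) ^ (Nat.log 2 j + 1) := by gcongr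
    _ ≤ (4 * ℓ ^ 2) ^ (Nat.log 2 ℓ + 1) := by
        apply Nat.pow_le_pow_right
        · nlinarith
        · exact Nat.succ_le_succ (Nat.log_mono_right h)

/-- **POOR ⇒ involution words of radius `≤ L` are pairwise distinct permutations.**  The poorness
hypothesis is that of `stub_poorRigidCore` verbatim; a relator would have the `n` distinct fixed points
`id`, exceeding the threshold at length `4L + 2` (assumed `< n`, with `4L + 2 ≤ n^{1/4}` so that poorness
applies). [this line] -/
theorem invWord_injective_of_poor (μ : Fin 3 → Equiv.Perm (Fin n)) (hμ : ∀ c, μ c * μ c = 1)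
    (R : Finset (Fin n)) (L : ℕ)
    (hpoor : ∀ z : List (Fin 3), z ≠ [] → List.IsChain (· ≠ ·) (z ++ z) →
      (z.length : ℝ) ≤ (n : ℝ) ^ ((1 : ℝ) / 4) → ∀ (m : ℕ) (x : Fin m → Fin n), Function.Injective x →
      (∀ i, z.foldl (fun v c => μ c v) (x i) = x i) →
      m ≤ (4 * z.length ^ 2) ^ (Nat.log 2 z.length + 1) * (R.card + 1))
    (hL : ((4 * L + 2 : ℕ) : ℝ) ≤ (n : ℝ) ^ ((1 : ℝ) / 4))
    (hsmall : (4 * (4 * L + 2) ^ 2) ^ (Nat.log 2 (4 * L + 2) + 1) * (R.card + 1) < n)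
    (w w' : List (Fin 3)) (c c' : Fin 3) (hwL : w.length ≤ L) (hw'L : w'.length ≤ L)
    (hch : List.IsChain (· ≠ ·) (w ++ [c])) (hch' : List.IsChain (· ≠ ·) (w' ++ [c']))
    (h : ∀ v : Fin n, (w ++ c :: w.reverse).foldl (fun v c => μ c v) v =
      (w' ++ c' :: w'.reverse).foldl (fun v c => μ c v) v) :
    w = w' ∧ c = c' := by
  refine invWord_injective_of_noRelator μ hμ L ?_ w w' c c' hwL hw'L hch hch' h
  intro z hz0 hzc hzl
  by_contra hall
  push Not at hall
  have hlen : (z.length : ℝ) ≤ (n : ℝ) ^ ((1 : ℝ) / 4) :=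
    le_trans (by exact_mod_cast hzl) hL
  have hm := hpoor z hz0 hzc hlen n id Function.injective_id (fun i => hall i)
  have hmono := Nat.mul_le_mul_right (R.card + 1) (threshold_mono hzl)
  exact absurd (lt_of_le_of_lt (le_trans hm hmono) hsmall) (lt_irrefl n)

end Summit.MatrixMultiplication.MatrixMultiplication.Theorems.HyperoctahedralThreshold.InvolutionWordRelator
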